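import Literature.NumberTheory.LFunctions.WeilTwoPrimeDeflL2Base
import Literature.NumberTheory.LFunctions.WeilBlockRowsPZ
import HarnessLib

/-!
# Deflated two-prime certificate L2: the factored even inverse agrees with `D`, rows 8–15

`WeilCert.checkDnRow` (even block) for certificate L2, by `decide +kernel`. Pure proof file.
-/

noncomputable section

namespace Literature.NumberTheory.LFunctions

set_option maxHeartbeats 0 in
/-- Row 8 of `DnE/LsE` is row 8 of the even `D` (certificate L2). [folklore] -/
theorem checkDnRow0_8_weilCertDeflL2 : weilCertDeflL2Base.checkDnRow weilCertDeflL2DnE weilCertDeflL2LsE 0 8 = true := by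
  decide +kernel

set_option maxHeartbeats 0 in
/-- Row 9 of `DnE/LsE` is row 9 of the even `D` (certificate L2). [folklore] -/
theorem checkDnRow0_9_weilCertDeflL2 : weilCertDeflL2Base.checkDnRow weilCertDeflL2DnE weilCertDeflL2LsE 0 9 = true := by
  decide +kernel

set_option maxHeartbeats 0 in
/-- Row 10 of `DnE/LsE` is row 10 of the even `D` (certificate L2). [folklore] -/
theorem checkDnRow0_10_weilCertDeflL2 : weilCertDeflL2Base.checkDnRow weilCertDeflL2DnE weilCertDeflL2LsE 0 10 = true := by
  decide +kernel

set_option maxHeartbeats 0 in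
/-- Row 11 of `DnE/LsE` is row 11 of the even `D` (certificate L2). [folklore] -/
theorem checkDnRow0_11_weilCertDeflL2 : weilCertDeflL2Base.checkDnRow weilCertDeflL2DnE weilCertDeflL2LsE 0 11 = true := by
  decide +kernel

set_option maxHeartbeats 0 in
/-- Row 12 of `DnE/LsE` is row 12 of the even `D` (certificate L2). [folklore] -/
theorem checkDnRow0_12_weilCertDeflL2 : weilCertDeflL2Base.checkDnRow weilCertDeflL2DnE weilCertDeflL2LsE 0 12 = true := by
  decide +kernel

set_option maxHeartbeats 0 in
/-- Row 13 of `DnE/LsE` is row 13 of the even `D` (certificate L2). [folklore] -/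
theorem checkDnRow0_13_weilCertDeflL2 : weilCertDeflL2Base.checkDnRow weilCertDeflL2DnE weilCertDeflL2LsE 0 13 = true := by
  decide +kernel

set_option maxHeartbeats 0 in
/-- Row 14 of `DnE/LsE` is row 14 of the even `D` (certificate L2). [folklore] -/
theorem checkDnRow0_14_weilCertDeflL2 : weilCertDeflL2Base.checkDnRow weilCertDeflL2DnE weilCertDeflL2LsE 0 14 = true := by
  decide +kernel

set_option maxHeartbeats 0 in
/-- Row 15 of `DnE/LsE` is row 15 of the even `D` (certificate L2). [folklore] -/
theorem checkDnRow0_15_weilCertDeflL2 : weilCertDeflL2Base.checkDnRow weilCertDeflL2DnE weilCertDeflL2LsE 0 15 = true := by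
  decide +kernel


end Literature.NumberTheory.LFunctions
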